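import Literature.AlgebraicGeometry.Resolution.BlowupSequences
import Literature.AlgebraicGeometry.Resolution.BlowupsComposition
import Literature.AlgebraicGeometry.Resolution.NormalCrossingsStrictification
import Mathlib.AlgebraicGeometry.Noetherian
import HarnessLib

/-!
# Crux `PatchingRel` (stmt-ResolutionOfSingularities-0642), line `sandwiched-gluing` (v3 cut),
# stub `stub_exists_isBlowup_comp_of_centresOver`

**A sequence of blowing ups of a Noetherian scheme with centres over `T` is one `T`-supported
blowing up** (Temkin 2008, Lemma 2.1.4: "If `X` is coherent, `V ↪ X` is open and `T = X ∖ V`,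
then a composition of `V`-admissible (or `T`-supported) blow ups is a `V`-admissible (or
`T`-supported) blow up"; Stacks, Tag 080B: "Composition of blowing ups is a blowing up"), iterating
the two-step Noetherian form `IsBlowup.exists_isBlowup_comp_supported`
(`Literature/AlgebraicGeometry/Resolution/BlowupsComposition.lean`) along a multiple blow-up given
as data (`CentreSeq`, BGMW 2011, Def. 3.1.4; `BlowupSequences.lean`):

* `CentreSeq.exists_isBlowup_comp_of_centresOver` — for a multiple blow-up `s : CentreSeq X` of a
  Noetherian scheme `X` whose centres lie over `T ⊆ X` (`s.CentresOver T`), the composite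
  `s.comp : X_r → X` is a blowing up of `X` along an ideal sheaf supported in `T`. Induction
  descending the tower: the empty sequence is the blowing up along `⊤` (`isBlowup_id_top`), and
  for `cons C rest` the rest of the sequence lives on `Bl_C(X)`, which is again Noetherian
  (`isNoetherian_of_isBlowup`, `NormalCrossingsStrictification.lean`), so it is a
  `σ_1⁻¹ T`-supported blowing up by induction and composes with `σ_1 : Bl_C(X) → X`;
* `stub_exists_isBlowup_comp_of_centresOver` — the registered universe-`0` stub.

The analogous statement for the `Prop`-valued embedded transforms `IsEmbeddedTransform Y T σ Y'`
of `EmbeddedResolution.lean` (generated by APPENDING blow-ups, so that only the base needs to be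
Noetherian) is already in the tree: `IsEmbeddedTransform.exists_isBlowup`
(`Literature/AlgebraicGeometry/Resolution/GenericFibreResolutionDatum.lean`); the present version
needs no regularity of the centres.

Use on the line: resolution algorithms (Hironaka; Cossart–Jannsen–Saito) output SEQUENCES of
blowing ups with centres over the singular locus, while the v3 atom SAND⁺ᵇ asks for ONE blowing
up `Bl_J V → V` with `J` cosupported in `Sing V`; by this file the single-blow-up format loses
nothing.

## References

* M. Temkin, *Desingularization of quasi-excellent schemes in characteristic zero*, Adv. Math.
  219 (2008) 488–522, §2.1, Lemma 2.1.4. [Temkin2008]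
* The Stacks Project, Tag 080B (composition of blowing ups of finite type is a blowing up).
  [StacksProject]
* E. Bierstone, D. Grigoriev, P. Milman, J. Włodarczyk, *Effective Hironaka resolution and its
  complexity*, Asian J. Math. 15 (2011) 193–228, Def. 3.1.4.
  [BierstoneGrigorievMilmanWlodarczyk2011]
-/

-- `Summit.<Summit>.<Sub>.Theorems` with `Sub = Summit` (single-conjunct summit, D-0017): the
-- duplicated namespace component is the tree layout.
set_option linter.dupNamespace false

noncomputable section

namespace Summit.ResolutionOfSingularities.ResolutionOfSingularities.Theorems

open CategoryTheory AlgebraicGeometry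
open Literature.AlgebraicGeometry.Resolution

universe u

/-- **Temkin 2008, Lemma 2.1.4, for multiple blow-ups as data** (Stacks 080B iterated): if
`s = (X = X_0 ← Bl_{C_0} X_0 = X_1 ← ⋯ ← X_r)` is a multiple blow-up of a Noetherian scheme `X`
whose centres lie over `T ⊆ X` (`C_0 ⊆ T`, `C_1 ⊆ σ_1⁻¹ T`, …), then the composite
`σ_1 ∘ ⋯ ∘ σ_r : X_r → X` is a blowing up of `X` along an ideal sheaf `Q` with `Supp Q ⊆ T`.
Induction on `s`: the empty sequence is the blowing up along `⊤` (support `∅`); for `cons C rest`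
the rest is a `σ_1⁻¹ T`-supported blowing up of the Noetherian scheme `Bl_C(X)`
(`isNoetherian_of_isBlowup`) by induction, and `IsBlowup.exists_isBlowup_comp_supported`
composes it with `σ_1 = Bl_C(X) → X`. [cite: Temkin2008, Lemma 2.1.4] -/
theorem CentreSeq.exists_isBlowup_comp_of_centresOver :
    ∀ {X : Scheme.{u}} [IsNoetherian X] (s : CentreSeq X) (T : Set X), s.CentresOver T →
      ∃ Q : X.IdealSheafData, IsBlowup s.comp Q ∧ (Q.support : Set X) ⊆ T
  | X, _, .nil _, T, _ =>
    show ∃ Q : X.IdealSheafData, IsBlowup (𝟙 X) Q ∧ (Q.support : Set X) ⊆ T from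
      ⟨⊤, isBlowup_id_top X, by simp⟩
  | X, _, .cons C rest, T, h => by
    obtain ⟨hCT, hrest⟩ := h
    haveI : IsNoetherian (blowup C) := isNoetherian_of_isBlowup (blowup.isBlowup C)
    obtain ⟨Q', hQ', hQ'T⟩ := CentreSeq.exists_isBlowup_comp_of_centresOver rest _ hrest
    show ∃ Q : X.IdealSheafData, IsBlowup (rest.comp ≫ blowup.π C) Q ∧ (Q.support : Set X) ⊆ T
    exact IsBlowup.exists_isBlowup_comp_supported (blowup.π C) C rest.comp Q' T
      (blowup.isBlowup C) hCT hQ' hQ'T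

/-- **Stub `stub_exists_isBlowup_comp_of_centresOver` of line `sandwiched-gluing`** (crux
`PatchingRel`, stmt-ResolutionOfSingularities-0642), the universe-`0` instance of
`CentreSeq.exists_isBlowup_comp_of_centresOver`: a blow-up sequence of a Noetherian scheme with
centres over `T` composes to one blowing up along an ideal sheaf supported in `T`
(Temkin 2008, Lemma 2.1.4; Stacks 080B). [cite: Temkin2008, Lemma 2.1.4] -/
theorem stub_exists_isBlowup_comp_of_centresOver :
    ∀ (X : Scheme.{0}) [IsNoetherian X] (s : Literature.AlgebraicGeometry.Resolution.CentreSeq X)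
      (T : Set X), s.CentresOver T →
      ∃ Q : X.IdealSheafData, IsBlowup s.comp Q ∧ (Q.support : Set X) ⊆ T :=
  fun _ _ s T h => CentreSeq.exists_isBlowup_comp_of_centresOver s T h

end Summit.ResolutionOfSingularities.ResolutionOfSingularities.Theorems

end
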